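import Mathlib
import Summits.NavierStokesRegularity.NavierStokesRegularity.Theorems.OrthantWakeForwardBreakOfWake
import HarnessLib

/-!
# Route OrthantWake (rev 5) — the glue `KPBreakOfBlockWake` (item stmt-NavierStokesRegularity-27001)

The rev-5 crux `KPBlockWake` (item 26999) ratchets the forward-source tail energies
`T⁺_a(u) = Σ_j Σ_{i∈S} ½X_{i,a+j}(u)²` per BLOCK of `L` shells,
`T⁺_{n+L}(t) ≤ (1+ε₀)^{-(1+η)L} · T⁺_n(u)` for some `u ≤ t`, at every shell `n ≥ κ₁/ε₀`, on Tao-type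
MODEL lattices of ORTHANT tables with DIAGONAL feed forms (Katz–Pavlović networks proper), with
`η, L, κ₁, ε̄` chosen before `ε₀, ν, α`. This file proves the glue item:

* `forwardBreak_blockEnvelope` — block ratchet on running maxima from the transient depth `n₁`
  plus `T⁺ ≤ E₀` ⇒ the window-, horizon- and `ν`-independent subcritical envelope
  `Σ_{k=n}^{N} Σ_{i∈S} ½X_{i,k}(t)² ≤ E₀ (1+ε₀)^{(1+η)(n₁+L)} (1+ε₀)^{-(1+η)n}` (the argument of
  `forwardBreak_envelope`, p612870, on the coarse lattice of ratio `(1+ε₀)^L`, with the shells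
  between two rungs handled by the monotonicity of tails in the shell index);
* `kpBreakOfBlockWake_proof : KPBreakOfBlockWake` — `KPBlockWake → OrthantInvariance →
  ForwardSourceSmoothing → (∀ R ≥ 1 ∃ εR ∀ ε₀ ≤ εR ∀ KP-proper orthant α ∈ E₂(R) ∀ X₀,
  ¬NoGlobalCascade ε₀ α X₀)`: exactly `forwardBreakOfWake_proof` with the block envelope; the
  diagonal-feed clause is only carried.

HONEST FRAMING: MODEL lattice statements (rung TL-M2Break); the glue is an implication whose
first hypothesis `KPBlockWake` is an OPEN crux (its one-mode special case — a `ν`-uniform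
super-critical block wake for the Katz–Pavlović chain at every small scale ratio — is open in
print); nothing here is a statement about the Navier–Stokes equations and no summit is proved.
References for the vocabulary: [cite: Tao2016AveragedNS, §4 (4.2)–(4.3), (4.8), Lemma 4.1];
positivity of KP networks: [cite: BarbatoMorandinRomito2011, §2].
-/

noncomputable section

-- the sub-problem namespace `NavierStokesRegularity.NavierStokesRegularity` is the tree's layout (D-0017)
set_option linter.dupNamespace false

namespace Summit.NavierStokesRegularity.NavierStokesRegularity.Theorems

open Set Filter
open scoped Topology
open Literature.Analysis.FluidPDE.TaoCascade

/-! ## Tails are antitone in the shell index -/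

/-- For a non-negative summable sequence, the tail from `a` is below the tail from `a'` whenever
`a' ≤ a`. [this file] -/
theorem forwardBreak_tail_mono {f : ℕ → ℝ} (hf : ∀ j, 0 ≤ f j) (hs : Summable f) {a a' : ℕ}
    (h : a' ≤ a) : ∑' j, f (a + j) ≤ ∑' j, f (a' + j) := by
  obtain ⟨d, rfl⟩ := Nat.exists_eq_add_of_le h
  have hs' : Summable fun j => f (a' + j) := (summable_nat_add_iff a').2 hs |>.congr
    (fun j => by rw [add_comm])
  have := orthantBreak_tail_le (f := fun j => f (a' + j)) (fun j => hf _) hs' d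
  have h2 : (∑' j, f (a' + (d + j))) = ∑' j, f (a' + d + j) :=
    tsum_congr fun j => by rw [add_assoc]
  rw [h2] at this
  exact this

/-! ## From the BLOCK ratchet to the forward-source envelope -/

/-- **`S`-block-ratchet ⇒ `S`-envelope.** If the forward-source tails
`T⁺_a(u) = Σ_j Σ_{i∈S} ½X_{i,a+j}(u)²` are summable and `≤ E₀` on `[0,s]`, and beyond the transient
depth (`ε₀ n ≥ κ₁`, in particular for `n ≥ n₁` when `κ₁ ≤ ε₀ n₁`) every BLOCK of `L ≥ 1` shells
ratchets `T⁺` down by `(1+ε₀)^{-(1+η)L}` against an earlier time, then every finite block of shells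
obeys the subcritical envelope
`Σ_{k=n}^{N} Σ_{i∈S} ½X_{i,k}(t)² ≤ E₀ (1+ε₀)^{(1+η)(n₁+L)} (1+ε₀)^{-(1+η)n}`. [this file] -/
theorem forwardBreak_blockEnvelope {ε₀ η κ₁ s E₀ : ℝ} (hε : 0 < ε₀) {n₁ L : ℕ} (hL : 1 ≤ L)
    (hn₁ : κ₁ ≤ ε₀ * n₁) (S : Finset (Fin 4)) {X : Fin 4 → ℤ → ℝ → ℝ}
    (hsum : ∀ (a : ℕ) (t : ℝ),
      Summable fun j : ℕ => ∑ i ∈ S, (1 / 2 : ℝ) * X i ((a : ℤ) + (j : ℤ)) t ^ 2)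
    (hTle : ∀ (a : ℕ), ∀ t ∈ Icc (0 : ℝ) s,
      (∑' j : ℕ, ∑ i ∈ S, (1 / 2 : ℝ) * X i ((a : ℤ) + (j : ℤ)) t ^ 2) ≤ E₀)
    (hratchet : ∀ n : ℕ, κ₁ ≤ ε₀ * n → ∀ t ∈ Icc (0 : ℝ) s, ∃ u ∈ Icc (0 : ℝ) t,
      (∑' j : ℕ, ∑ i ∈ S, (1 / 2 : ℝ) * X i ((n + L : ℕ) + (j : ℤ)) t ^ 2) ≤
        (1 + ε₀) ^ (-((1 + η) * (L : ℝ))) *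
          (∑' j : ℕ, ∑ i ∈ S, (1 / 2 : ℝ) * X i ((n : ℕ) + (j : ℤ)) u ^ 2))
    (hη : 0 < η) (n N : ℕ) {t : ℝ} (ht : t ∈ Icc (0 : ℝ) s) :
    ∑ k ∈ Finset.Icc n N, ∑ i ∈ S, (1 / 2 : ℝ) * X i (k : ℤ) t ^ 2 ≤
      (E₀ * (1 + ε₀) ^ ((1 + η) * ((n₁ + L : ℕ) : ℝ))) * (1 + ε₀) ^ (-((1 + η) * (n : ℝ))) := by
  have h0 : (0 : ℝ) < 1 + ε₀ := by linarith
  have h1 : (1 : ℝ) ≤ 1 + ε₀ := by linarith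
  set T : ℕ → ℝ → ℝ := fun a u =>
    ∑' j : ℕ, ∑ i ∈ S, (1 / 2 : ℝ) * X i ((a : ℤ) + (j : ℤ)) u ^ 2 with hT
  have hnonneg : ∀ (u : ℝ) (j : ℕ), 0 ≤ ∑ i ∈ S, (1 / 2 : ℝ) * X i (j : ℤ) u ^ 2 :=
    fun u j => Finset.sum_nonneg fun i _ => by positivity
  have hE0 : 0 ≤ E₀ := (tsum_nonneg fun j => hnonneg t (0 + j)).trans (by simpa using hTle 0 t ht)
  -- tails are antitone in the shell index
  have hmono : ∀ (u : ℝ) {a a' : ℕ}, a' ≤ a → T a u ≤ T a' u := by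
    intro u a a' haa
    have hs0 : Summable fun j : ℕ => ∑ i ∈ S, (1 / 2 : ℝ) * X i (j : ℤ) u ^ 2 :=
      (hsum 0 u).congr fun j => by simp
    have h := forwardBreak_tail_mono (f := fun j : ℕ => ∑ i ∈ S, (1 / 2 : ℝ) * X i (j : ℤ) u ^ 2)
      (hnonneg u) hs0 haa
    have ha : (∑' j : ℕ, ∑ i ∈ S, (1 / 2 : ℝ) * X i ((a + j : ℕ) : ℤ) u ^ 2) = T a u := by
      simp only [hT, Nat.cast_add]
    have ha' : (∑' j : ℕ, ∑ i ∈ S, (1 / 2 : ℝ) * X i ((a' + j : ℕ) : ℤ) u ^ 2) = T a' u := by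
      simp only [hT, Nat.cast_add]
    rw [ha, ha'] at h
    exact h
  -- iterate the block ratchet from the transient depth along the rungs `n₁ + d L`
  have hiter : ∀ d : ℕ, ∀ u ∈ Icc (0 : ℝ) s,
      T (n₁ + d * L) u ≤ E₀ * (1 + ε₀) ^ (-((1 + η) * ((d * L : ℕ) : ℝ))) := by
    intro d
    induction d with
    | zero =>
      intro u hu
      have h : T n₁ u ≤ E₀ := hTle n₁ u hu
      simpa using h
    | succ d ih =>
      intro u hu
      have hnd : κ₁ ≤ ε₀ * ((n₁ + d * L : ℕ) : ℝ) := by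
        push_cast
        nlinarith [mul_nonneg hε.le (by positivity : (0 : ℝ) ≤ (d : ℝ) * (L : ℝ))]
      obtain ⟨v, hv, hle⟩ := hratchet (n₁ + d * L) hnd u hu
      have hv' : v ∈ Icc (0 : ℝ) s := ⟨hv.1, hv.2.trans hu.2⟩
      have h3 := ih v hv'
      have hr : 0 ≤ (1 + ε₀) ^ (-((1 + η) * (L : ℝ))) := Real.rpow_nonneg h0.le _
      have hidx : n₁ + (d + 1) * L = n₁ + d * L + L := by ring
      have hexp : -((1 + η) * (((d + 1) * L : ℕ) : ℝ)) =
          -((1 + η) * (L : ℝ)) + -((1 + η) * ((d * L : ℕ) : ℝ)) := by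
        push_cast
        ring
      calc T (n₁ + (d + 1) * L) u = T (n₁ + d * L + L) u := by rw [hidx]
        _ ≤ (1 + ε₀) ^ (-((1 + η) * (L : ℝ))) * T (n₁ + d * L) v := hle
        _ ≤ (1 + ε₀) ^ (-((1 + η) * (L : ℝ))) * (E₀ * (1 + ε₀) ^ (-((1 + η) * ((d * L : ℕ) : ℝ)))) :=
            mul_le_mul_of_nonneg_left h3 hr
        _ = E₀ * (1 + ε₀) ^ (-((1 + η) * (((d + 1) * L : ℕ) : ℝ))) := by
            rw [hexp, Real.rpow_add h0]
            ring
  -- the envelope for every shell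
  have hTall : ∀ (a : ℕ), ∀ u ∈ Icc (0 : ℝ) s,
      T a u ≤ (E₀ * (1 + ε₀) ^ ((1 + η) * ((n₁ + L : ℕ) : ℝ))) *
        (1 + ε₀) ^ (-((1 + η) * (a : ℝ))) := by
    intro a u hu
    rcases le_or_gt n₁ a with hle | hlt
    · -- `a = n₁ + d L + r` with `r < L`: compare with the rung `n₁ + d L`
      obtain ⟨e, rfl⟩ := Nat.exists_eq_add_of_le hle
      have hLpos : 0 < L := hL
      set d := e / L with hd
      set r := e % L with hr
      have her : e = d * L + r := by rw [hd, hr, Nat.mul_comm]; exact (Nat.div_add_mod e L).symm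
      have hrL : r < L := Nat.mod_lt e hLpos
      have hrung : T (n₁ + e) u ≤ T (n₁ + d * L) u := hmono u (by omega)
      have h := hiter d u hu
      have hexp : E₀ * (1 + ε₀) ^ (-((1 + η) * ((d * L : ℕ) : ℝ))) ≤
          (E₀ * (1 + ε₀) ^ ((1 + η) * ((n₁ + L : ℕ) : ℝ))) *
            (1 + ε₀) ^ (-((1 + η) * ((n₁ + e : ℕ) : ℝ))) := by
        rw [mul_assoc, ← Real.rpow_add h0]
        refine mul_le_mul_of_nonneg_left (Real.rpow_le_rpow_of_exponent_le h1 ?_) hE0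
        have hr' : (r : ℝ) ≤ (L : ℝ) := by exact_mod_cast hrL.le
        have hcast : ((n₁ + e : ℕ) : ℝ) = (n₁ : ℝ) + (d : ℝ) * (L : ℝ) + (r : ℝ) := by
          rw [her]; push_cast; ring
        rw [hcast]
        push_cast
        nlinarith [mul_nonneg (by linarith : (0 : ℝ) ≤ 1 + η) (sub_nonneg.2 hr')]
      exact (hrung.trans h).trans hexp
    · have h := hTle a u hu
      have ha : (a : ℝ) ≤ ((n₁ + L : ℕ) : ℝ) := by push_cast; exact_mod_cast (by omega : a ≤ n₁ + L)
      have hexp : (1 : ℝ) ≤ (1 + ε₀) ^ ((1 + η) * ((n₁ + L : ℕ) : ℝ)) *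
          (1 + ε₀) ^ (-((1 + η) * (a : ℝ))) := by
        rw [← Real.rpow_add h0]
        refine Real.one_le_rpow h1 ?_
        nlinarith [mul_nonneg (by linarith : (0 : ℝ) ≤ 1 + η) (sub_nonneg.2 ha)]
      calc T a u ≤ E₀ := h
        _ = E₀ * 1 := (mul_one _).symm
        _ ≤ E₀ * ((1 + ε₀) ^ ((1 + η) * ((n₁ + L : ℕ) : ℝ)) *
              (1 + ε₀) ^ (-((1 + η) * (a : ℝ)))) := mul_le_mul_of_nonneg_left hexp hE0
        _ = (E₀ * (1 + ε₀) ^ ((1 + η) * ((n₁ + L : ℕ) : ℝ))) *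
              (1 + ε₀) ^ (-((1 + η) * (a : ℝ))) := by ring
  -- finite blocks are below the tail
  have hsn : Summable fun j : ℕ => ∑ i ∈ S, (1 / 2 : ℝ) * X i ((n + j : ℕ) : ℤ) t ^ 2 :=
    (hsum n t).congr fun j => by simp [Nat.cast_add]
  have hpart := orthantBreak_partial_le
    (f := fun k : ℕ => ∑ i ∈ S, (1 / 2 : ℝ) * X i (k : ℤ) t ^ 2) (hnonneg t) n N hsn
  have h2 : ∑' j : ℕ, ∑ i ∈ S, (1 / 2 : ℝ) * X i ((n + j : ℕ) : ℤ) t ^ 2 = T n t := by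
    simp only [hT, Nat.cast_add]
  rw [h2] at hpart
  exact hpart.trans (hTall n t ht)

/-! ## The item -/

/-- **Item stmt-NavierStokesRegularity-27001** (`OrthantWake.KPBreakOfBlockWake`): the block
forward-source ratchet on KP networks proper (`KPBlockWake`), Kamke cone invariance
(`OrthantInvariance`) and forward-source envelope smoothing (`ForwardSourceSmoothing`) imply the
KP-orthant conjunct of the rung target — for every `R ≥ 1` there is `εR > 0` such that for
`ε₀ ≤ εR` no orthant table of `E₂(R)` with diagonal feed forms exhibits Theorem-4.2-level blow-up
from any one-shell datum. The envelope constant handed to the smoothing hypothesis is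
`E₀ (1+ε₀)^{(1+η)(⌈κ₁/ε₀⌉+L)}`, independent of the horizon, the window and `ν`. MODEL lattice
statement; a glue between OPEN and proved items; no Navier–Stokes statement is proved. [this file] -/
theorem kpBreakOfBlockWake_proof :
    Summit.NavierStokesRegularity.NavierStokesRegularity.Theses.OrthantWake.KPBreakOfBlockWake := by
  unfold Summit.NavierStokesRegularity.NavierStokesRegularity.Theses.OrthantWake.KPBreakOfBlockWake
    Summit.NavierStokesRegularity.NavierStokesRegularity.Theses.OrthantWake.KPBlockWake
    Summit.NavierStokesRegularity.NavierStokesRegularity.Theses.OrthantWake.OrthantInvariance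
    Summit.NavierStokesRegularity.NavierStokesRegularity.Theses.OrthantWake.ForwardSourceSmoothing
  intro hW hI hB R hR
  obtain ⟨η, hη, L, hL, κ₁, _hκ₁, εb, hεb, _hεb1, H⟩ := hW R hR
  refine ⟨εb, hεb, fun ε₀ hε₀ hle α X₀ hα hK hKP hNG => ?_⟩
  obtain ⟨κ, hκ, hno⟩ := (noGlobalCascade_iff_kappa hε₀).1 hNG
  have h2 : 0 < Real.sqrt 2 := Real.sqrt_pos.2 two_pos
  have hν : 0 < κ / Real.sqrt 2 := div_pos hκ h2
  -- the source set and the block ratchet at this viscosity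
  obtain ⟨S, hS, HS⟩ := H ε₀ hε₀ hle (κ / Real.sqrt 2) hν α hα hK hKP
  -- the transient depth in shells and the envelope constant
  obtain ⟨n₁, hn₁⟩ : ∃ n₁ : ℕ, κ₁ ≤ ε₀ * n₁ := by
    refine ⟨⌈κ₁ / ε₀⌉₊, ?_⟩
    have := Nat.le_ceil (κ₁ / ε₀)
    rwa [div_le_iff₀' hε₀] at this
  obtain ⟨X, hX⟩ := hB ε₀ η R hε₀ hη α hα S hS X₀ (κ / Real.sqrt 2) hν
    (fun T _hT => ⟨(∑ i : Fin 4, (1 / 2 : ℝ) * X₀ i ^ 2) * (1 + ε₀) ^ ((1 + η) * ((n₁ + L : ℕ) : ℝ)),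
      fun s hs Y hinit hlow hbd hcont hder n N _hnN t ht => by
        obtain ⟨M, hM⟩ := hbd
        have hnonneg := hI ε₀ (κ / Real.sqrt 2) hε₀ hν α hK X₀ s hs.1 Y hinit hlow ⟨M, hM⟩
          hcont hder
        have hrat := HS X₀ s hs.1 Y hinit hlow ⟨M, hM⟩ hcont hder hnonneg
        -- every forward-source tail is below the total energy, hence below `E₀`
        have hTle : ∀ (a : ℕ), ∀ u ∈ Icc (0 : ℝ) s,
            (∑' j : ℕ, ∑ i ∈ S, (1 / 2 : ℝ) * Y i ((a : ℤ) + (j : ℤ)) u ^ 2) ≤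
              ∑ i : Fin 4, (1 / 2 : ℝ) * X₀ i ^ 2 := by
          intro a u hu
          have hfull := orthantBreak_summable hε₀ hM a u
          have hs0 : Summable fun j : ℕ => ∑ i : Fin 4, (1 / 2 : ℝ) * Y i (j : ℤ) u ^ 2 :=
            (orthantBreak_summable hε₀ hM 0 u).congr fun j => by simp
          have hnn : ∀ j : ℕ, 0 ≤ ∑ i : Fin 4, (1 / 2 : ℝ) * Y i (j : ℤ) u ^ 2 :=
            fun j => Finset.sum_nonneg fun i _ => by positivity
          calc (∑' j : ℕ, ∑ i ∈ S, (1 / 2 : ℝ) * Y i ((a : ℤ) + (j : ℤ)) u ^ 2)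
              ≤ ∑' j : ℕ, ∑ i : Fin 4, (1 / 2 : ℝ) * Y i ((a : ℤ) + (j : ℤ)) u ^ 2 :=
                (forwardBreak_summable hε₀ S hM a u).tsum_le_tsum
                  (fun j => forwardBreak_sSum_le S Y _ u) hfull
            _ = ∑' j : ℕ, ∑ i : Fin 4, (1 / 2 : ℝ) * Y i ((a + j : ℕ) : ℤ) u ^ 2 := by
                simp only [Nat.cast_add]
            _ ≤ ∑' j : ℕ, ∑ i : Fin 4, (1 / 2 : ℝ) * Y i (j : ℤ) u ^ 2 :=
                orthantBreak_tail_le hnn hs0 a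
            _ ≤ ∑ i : Fin 4, (1 / 2 : ℝ) * X₀ i ^ 2 :=
                orthantBreak_energy_le hε₀ hν hα.2.1 hinit hlow hM hder hu
        exact forwardBreak_blockEnvelope hε₀ hL hn₁ S (forwardBreak_summable hε₀ S hM) hTle hrat hη
          n N ht⟩)
  have hG := hasGlobal_of_viscousGlobal hε₀ hν.le hX
  rw [div_mul_cancel₀ κ h2.ne'] at hG
  exact hno (hasGlobal_mono hε₀.le hG le_rfl hκ.le)

end Summit.NavierStokesRegularity.NavierStokesRegularity.Theorems

end
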